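import Mathlib
import Summits.ValiantsHypothesis.ValiantsHypothesis.Theorems.BinomialElusiveBinomialCandidateInfinityGlue
import Summits.ValiantsHypothesis.ValiantsHypothesis.Theorems.BinomialElusiveBinomialCandidateInfinityCommonZero
import Summits.ValiantsHypothesis.ValiantsHypothesis.Theorems.BinomialElusiveBinomialCandidateExpoGrowth
import Summits.ValiantsHypothesis.ValiantsHypothesis.Theorems.BinomialElusiveRazTransferCircuit

/-!
# Crux `BinomialElusive.BinomialCandidate` (stmt-ValiantsHypothesis-7392), line `registered` —
# X holds for GENERIC quadratic maps (the place at infinity, skeleton v4)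

The first consequence of the two wave-1 stubs at the place over `x = ∞`
(`stub_infinityGlue`, `stub_infinityCommonZero`): a binomial curve
`x ↦ (x^{a_i} + x^{b_i})_i` with `a_i < b_i` and pairwise distinct top exponents `b_i` is contained
in the image of NO quadratic map `Γ : ℂ^s → ℂ^m` whose quadratic parts
`B_i = homogeneousComponent 2 (Γ i)` are in general position in the following weak sense: for
every nonzero `z ∈ ℂ^s` at least TWO of the `B_i` do not vanish at `z` (equivalently: no `m - 1`
of the `m` quadratic parts have a common nontrivial zero).  For `s = m - 1` this is the complement
of a proper Zariski-closed subset of the space of quadratic maps (`m - 1` quadrics in `ℙ^{m-2}`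
have no common point in general), so the crux X — and Raz's `(m-1, 2)`-question for these curves —
is settled for generic `Γ`; every possible swallower is "near-ruled" (all but at most one of its
quadratic parts share a zero `z`; in coordinates with `z = e₁`, `Γ_i = y₁ A_i(y') + G_i(y')` for
`i ≠ τ`).

* `Generic.no_range_subset` — the general statement (any `m ≥ 1`, any `s`, any data with
  `a < b`, `b` injective).
* `binomialCandidate_generic` — the instance for the route's E-curve, `m ≥ 2`
  (`E` is strictly increasing, `ExpoGrowth.geom_sum_lt_of_lt`).

Proof: a containment gives a Laurent solution at infinity, `Γ_i(p) = t^{-N a_i} + t^{-N b_i}`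
(`stub_infinityGlue`); with `μ < 0` the least order of `p` and `z = p_μ ≠ 0`, every `i` has
`B_i(z) = 0 ∨ 2μ = -N b_i` (`stub_infinityCommonZero`), and the second alternative names `b_i`,
so it happens for at most one index.  No new analysis; Mathlib + the two stub files.
-/

-- layout Summits/ValiantsHypothesis/ValiantsHypothesis forces the duplicated namespace component
set_option linter.dupNamespace false

namespace Summit.ValiantsHypothesis.ValiantsHypothesis.Theorems.BinomialCandidateStubs

open scoped BigOperators

namespace Generic

/-- **Binomial curves elude generic quadratic maps.**  If `a_i < b_i`, `b` is injective, every
`Γ i` has total degree `≤ 2`, and for every nonzero `z` and every index `τ` some OTHER quadratic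
part `B_i`, `i ≠ τ`, does not vanish at `z`, then the curve `x ↦ (x^{a_i} + x^{b_i})_i` is not
contained in the image of `Γ`. -/
theorem no_range_subset {m s : ℕ} (hm : 0 < m) (a b : Fin m → ℕ) (hab : ∀ i, a i < b i)
    (hb : Function.Injective b) (Γ : Fin m → MvPolynomial (Fin s) ℂ)
    (hΓ : ∀ i, (Γ i).totalDegree ≤ 2)
    (hgen : ∀ z : Fin s → ℂ, z ≠ 0 → ∀ τ : Fin m, ∃ i, i ≠ τ ∧
      MvPolynomial.eval z (MvPolynomial.homogeneousComponent 2 (Γ i)) ≠ 0) :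
    ¬ Set.range (fun x : ℂ => fun i : Fin m => x ^ a i + x ^ b i) ⊆
        Set.range (fun y : Fin s → ℂ => fun i : Fin m => MvPolynomial.eval y (Γ i)) := by
  intro hsub
  obtain ⟨N, p, hN, hp⟩ := stub_infinityGlue m s a b Γ hm hΓ hsub
  obtain ⟨μ, _, _, hz, hB⟩ := stub_infinityCommonZero m s a b Γ N p hm hΓ hN hab hp
  -- the index (if any) whose top exponent realises `2μ`
  by_cases hτ : ∃ τ : Fin m, 2 * μ = -((N * b τ : ℕ) : ℤ)
  · obtain ⟨τ, hτ⟩ := hτ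
    obtain ⟨i, hiτ, hi⟩ := hgen _ hz τ
    rcases (hB i).2 with h | h
    · exact hi h
    · refine hiτ (hb (Nat.eq_of_mul_eq_mul_left hN ?_))
      have h1 : ((N * b i : ℕ) : ℤ) = ((N * b τ : ℕ) : ℤ) := by linarith
      exact_mod_cast h1
  · push Not at hτ
    obtain ⟨i, -, hi⟩ := hgen _ hz ⟨0, hm⟩
    exact hi (((hB i).2).resolve_right (hτ i))

end Generic

open Summit.ValiantsHypothesis.ValiantsHypothesis.Theorems.BinomialElusiveRazTransfer (expo)

/-- `E_m` is strictly increasing in `j` once `m ≥ 2` (then `h = ⌊log₂ m⌋² ≥ 1`). -/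
theorem expo_lt_expo_succ {m : ℕ} (hm : 2 ≤ m) (j : ℕ) : expo m j < expo m (j + 1) := by
  have hh : 1 ≤ Nat.log 2 m ^ 2 :=
    Nat.one_le_pow _ _ (Nat.log_pos (by norm_num) hm)
  unfold expo
  exact ExpoGrowth.geom_sum_lt_of_lt _ _ _ _ (Nat.one_le_pow _ _ (by omega)) hh (Nat.lt_succ_self j)

/-- `E_m` is strictly monotone once `m ≥ 2`. -/
theorem expo_strictMono {m : ℕ} (hm : 2 ≤ m) : StrictMono (expo m) :=
  strictMono_nat_of_lt_succ fun j => expo_lt_expo_succ hm j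

/-- **X for generic `Γ`** (crux `BinomialCandidate` off the resultant locus, every `m ≥ 2`): a
quadratic map `Γ : ℂ^{m-1} → ℂ^m` such that no `m - 1` of its `m` quadratic parts have a common
nontrivial zero (for every `z ≠ 0` and every `τ` some `B_i`, `i ≠ τ`, has `B_i(z) ≠ 0`) does not
contain the route's E-curve `x ↦ (x^{E(2i+1)} + x^{E(2i+2)})_i` in its image.  The exponents are
spelled out as in the route decl. -/
theorem binomialCandidate_generic :
    ∀ m ≥ 2, ∀ Γ : Fin m → MvPolynomial (Fin (m - 1)) ℂ, (∀ i, (Γ i).totalDegree ≤ 2) →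
      (∀ z : Fin (m - 1) → ℂ, z ≠ 0 → ∀ τ : Fin m, ∃ i, i ≠ τ ∧
        MvPolynomial.eval z (MvPolynomial.homogeneousComponent 2 (Γ i)) ≠ 0) →
      ¬ (Set.range (fun x : ℂ => fun i : Fin m =>
          x ^ (∑ k ∈ Finset.range (Nat.log 2 m ^ 2 + 1),
            ((2 * (i : ℕ) + 1) * (2 * m + 2) ^ (Nat.log 2 m ^ 2 + 1)) ^ k) +
          x ^ (∑ k ∈ Finset.range (Nat.log 2 m ^ 2 + 1),
            ((2 * (i : ℕ) + 2) * (2 * m + 2) ^ (Nat.log 2 m ^ 2 + 1)) ^ k)) ⊆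
        Set.range (fun y : Fin (m - 1) → ℂ => fun i : Fin m => MvPolynomial.eval y (Γ i))) := by
  intro m hm Γ hΓ hgen
  have hmono := expo_strictMono hm
  exact Generic.no_range_subset (by omega) (fun i : Fin m => expo m (2 * (i : ℕ) + 1))
    (fun i : Fin m => expo m (2 * (i : ℕ) + 2)) (fun i => hmono (by omega))
    (fun i j hij => Fin.ext (by have := hmono.injective hij; omega)) Γ hΓ hgen

end Summit.ValiantsHypothesis.ValiantsHypothesis.Theorems.BinomialCandidateStubs
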